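import Summits.Ventures.QEC.Census.CertBZPlaneTree
import Summits.Ventures.QEC.Census.TwoBGA.TB_l6m24_A0_0_0_1_3_11_B0_0_1_11_5_4.L1Tree0B
import Summits.Ventures.QEC.Census.TwoBGA.TB_l6m24_A0_0_0_1_3_11_B0_0_1_11_5_4.L1Tree0E
import HarnessLib

set_option Elab.async false
set_option maxRecDepth 200000

/-!
# `[[288,12,16]]` one-level cover certificate of `TB_l6m24_A0_0_0_1_3_11_B0_0_1_11_5_4` — LEVEL-1 list, matrix 0: adaptive split SUB-TREES t0_70_nil … t0_71_nil
(`CertBZPlaneTree`: `cutOK_succ` nodes over the family leaves of `L1Enum0*`; each theorem is «CutOK(c, P)» spelled out: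
the leaf `bzLeaf 14 eOrb` holds at every increasing selection of `≤ 7` rows of matrix 0 whose rows `≥ c` are exactly `P`). Theorems only; KERNEL. qec-search-1 g5.
-/

namespace Summit.Ventures.QEC.Census.TB_l6m24_A0_0_0_1_3_11_B0_0_1_11_5_4

open Summit.Ventures.QEC.Census

/-- CutOK(70, []) for matrix 0 (565 leaf families). -/
theorem t0_70_nil :
    ∀ J : List ℕ, J.Pairwise (· < ·) → (∀ j ∈ J, j < (giRows TB_l6m24_A0_0_0_1_3_11_B0_0_1_11_5_4.eGb eM0).length) → J.length ≤ 7 →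
      (J.filter fun j => decide (70 ≤ j)) = [] →
      bzLeaf 14 eOrb (xorFst (J.map fun j => (2 ^ j, (giRows eGb eM0).getD j 0))) (xorSnd (J.map fun j => (2 ^ j, (giRows eGb eM0).getD j 0))) = true :=
  (Plane.cutOK_succ 14 eOrb (giRows eGb eM0) 7
    t0_69_69
    t0_69_nil)

/-- CutOK(71, []) for matrix 0 (640 leaf families). -/
theorem t0_71_nil :
    ∀ J : List ℕ, J.Pairwise (· < ·) → (∀ j ∈ J, j < (giRows TB_l6m24_A0_0_0_1_3_11_B0_0_1_11_5_4.eGb eM0).length) → J.length ≤ 7 →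
      (J.filter fun j => decide (71 ≤ j)) = [] →
      bzLeaf 14 eOrb (xorFst (J.map fun j => (2 ^ j, (giRows eGb eM0).getD j 0))) (xorSnd (J.map fun j => (2 ^ j, (giRows eGb eM0).getD j 0))) = true :=
  (Plane.cutOK_succ 14 eOrb (giRows eGb eM0) 7
    t0_70_70
    t0_70_nil)


end Summit.Ventures.QEC.Census.TB_l6m24_A0_0_0_1_3_11_B0_0_1_11_5_4
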